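import Literature.MathematicalPhysics.QuantumFieldTheory.Balaban1983to89.NE2NodeTorus
import Summits.QuantumFields.BalabanUV.T4Continuum.Spine.NE2KingTransplant

/-!
# Route «BalabanUVNodes» (cluster K4 «SpineRates»), Track-A DAG node N15 = spine estimate NE2 «η-rate of the background-dependent linear
# theory» — THE KNIT, PART 2: what the node's type CONTAINS at the torus carriers of record (content extraction, a located negative, the
# node together with its trivial-background layers at `d + 1 = 4`), and the TYPED SOCKET of the background unit layer: King's scalar
# template (Lemma 4.5) transplanted — N15's unit conjunct at ANY background carrier family ⇐ King's four leaves uniformly over the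
# (3.35)∧(3.36)-regular backgrounds

Cell `pub-ymgap`, seat `pub-ymgap-dag-n15-a` (KNIT-BY-NAME; HUMAN RULING D-0062 «Track A at full width»; chair R424 venue, R429 «START HERE»;
YM-PLAN v0.12.15 §2c row N15; `pub-balaban-gaps/BALABAN-GAPS.md` v1.0 §C row NE2 l.47).  `bears_on: R4∕N15`.  Filed `--supports
stmt-QuantumFields-19351` (spine leaf `BalabanLadder.UV`) until the node stub `S_N15` of route «BalabanUVNodes» is an item.  THEOREMS ONLY
(0 `def`, 0 `sorry`, standard axioms); everything mathematical is a LANDED kernel theorem used BY NAME.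

WHAT N15 IS.  Statement of record (YM-PLAN §2c l.109; venue `HOME/lean/ym-dag/N15_NE2.lean` `YMDAG.N15`; dagwriter K4 `N15At`): the three NE2⁺
layers of `T4EtaRate` on ONE family of paired instances — `NE2PlusOperator c35 pi Kop ∧ NE2PlusSite 4 p c35 pi Ksite ∧ NE2PlusUnit c35 pi Kunit
inΛ unitDist`.  IN PRINT ∕ NOT IN PRINT: [B9] Thm 3.1 p. 397 ∕ Thm 3.2 (3.48) p. 398 ∕ Thm 3.15 (3.187) p. 432 print UNIFORMITY in the spacing,
never an η-difference; the only printed η-rate is King's scalar `A = 0` Lemma 4.5 (4.38) p. 674 (PRINTED + KERNEL, uncounted); the LG-vector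
layer at `U ≡ 1` is KERNEL (PART 1 = `Balaban1983to89.NE2NodeTorus`: `n15_knit_LG`); the BACKGROUND layer is NOT PRINTED ∕ NOT PROVED (WORK).

CONTENTS.
* §1 CONTENT AND A LOCATED NEGATIVE at the knit carriers of PART 1 (the referee's vacuity questions A1–A6 answered in kernel form):
  `stepBound_of_N15op` — from the node's FIRST conjunct at `knitInstance d L` one RECOVERS a genuine `(k, N)`-uniform King-shape step bound
  `|X_N (k+1)(x̄) − X_N k(x̄)| ≤ B₀·e^{−δ|x|_{T,∞}}·(L^{−γ})^k` on EVERY unit torus with `L ∣ N` (the guards `M₅ ≤ M`, `Mα₀ ≤ a₀`, (3.35) are all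
  dischargeable at every index: the type is not vacuous and not weaker than the tree's rate theorems); `not_N15op_rateless` — the rate-less
  family `X_N k ≡ 2^k` on the knit carriers at `L = 2` violates the first conjunct for EVERY `c35` (so the conjunct is not provable from the
  carriers' bookkeeping alone); `N15_with_zero_layers_dim4` — at `d + 1 = 4` the node for the LG-vector linear theory at `U ≡ 1` TOGETHER WITH
  its three trivial-background layers (`NE2ZeroOperator` = venue `N15zero`, `NE2ZeroSite`, `NE2ZeroUnit`), all hypothesis-free.
* §2 THE SOCKET OF THE BACKGROUND UNIT LAYER («the vector ∕ background layer by the scalar template»): `N15unit_of_covarianceTowerRate` — for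
  ANY family `pi` (any background carrier) whose unit kernel is the one-step η-difference of a tower of unit-lattice effective operators
  `(D_U (k+1) + B_U)⁻¹ − (D_U k + B_U)⁻¹` read at embedded sites, King's (4.38)-shape `NE2KingTransplant.CovarianceTowerRate` at every
  (3.35)∧(3.36)-regular `U` with index-uniform constants gives the node's unit conjunct `NE2PlusUnit`; `N15unit_of_kingLeaves` — the same from
  King's four LEAVES (H1) uniform coercivity ∧ (H2) Combes–Thomas row∕column bounds ∧ (H2′) kernel decay ∧ (H3) one-step sup rate of the
  effective operators ∧ (H4) volume sum, uniformly over the regular backgrounds, through the cell's kernel form of King's proof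
  `NE2KingTransplant.covarianceTowerRate_of_leaves` (pub-balaban t4-ne2-p3): constants `(δ₀, a₀, B₀, θ) = (κ∕2, a₀, √(2C₁ε)(γ−ρ−ρ_B)⁻²V², √r)`.
  (H1), (H2), (H2′), (H4) are ONE-RUN η-uniform bounds of PRINTED KIND ([B5] (1.67), [B6] (2.157), [B9] Thm 3.15); (H3) is the two-spacing leaf
  one layer below — at `U ≡ 1` a tree theorem (`T4Rate166StripDirect.W166_rate`), with background = the open estimate (the row owner's ROOT B
  `NE2BalabanThreshold.balaban_final_rate_of_regular` supplies it at MODEL level, conditional on N16's `NE3Shape` —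
  `NE2BalabanFinalRateCarriers.balaban_final_rate_of_ne3Shape_anyRate`, the N16 → N15 edge of record, not restated here).

HONEST SCOPE.  §1 lives at `U ≡ 1` on the collapsed single-scale torus model (PART 1's HONEST SCOPE (i)–(v) applies verbatim); §2 asserts nothing
of Bałaban's: every leaf is a BINDER, no carrier of [B9]'s `C^{(k)}(Λ; U)` is constructed, no `def … : Prop` is used as a hypothesis of anything but
the displayed socket theorems.  NOT a node discharge (the carriers of record of Bałaban's run are NODE 00's); count-neutral; one finite four-torus
programme at fixed ε; nothing about the continuum limit on ℝ⁴, infinite volume, OS axioms, a mass gap or the Clay problem.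
References (locators only, inherited from the imported modules' cross-read headers): [B5] = [Balaban1984PropagatorsI] CMP 95 (1984) (1.63) p. 28,
(1.66)–(1.67) p. 29; [B6] = [Balaban1984PropagatorsII] CMP 96 (1984) (2.156)–(2.157) p. 250; [B9] = [Balaban1985BackgroundPropagators] CMP 99 (1985)
(3.35)–(3.36) p. 396, (3.42) p. 397, Thm 3.2 (3.48) p. 398, Thm 3.15 (3.187) p. 432; [King1986] CMP 102 (1986) Lemma 4.3 (4.18) p. 672, (4.33)–(4.34),
Lemma 4.5 (4.38) p. 674.
-/

noncomputable section

namespace Summit.QuantumFields.YangMills.Theorems.BalabanUVNodesN15Knit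

open Literature.MathematicalPhysics.QuantumFieldTheory.Balaban1983to89
open Literature.MathematicalPhysics.QuantumFieldTheory.Balaban1983to89.T4EtaRate (PairedInstance EtaRateIneqUnit NE2PlusOperator NE2PlusSite
  NE2PlusUnit NE2ZeroOperator)
open Literature.MathematicalPhysics.QuantumFieldTheory.Balaban1983to89.T4EtaRateSiteOfRatePair (NE2ZeroSite)
open Literature.MathematicalPhysics.QuantumFieldTheory.Balaban1983to89.T4EtaRateUnitWitness (NE2ZeroUnit)
open Literature.MathematicalPhysics.QuantumFieldTheory.Balaban1983to89.T4EtaRateSiteTorus (TorusFamily etaRateIneqSite_torus_iff_lattice)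
open Literature.MathematicalPhysics.QuantumFieldTheory.Balaban1983to89.T4EtaRateOperatorTorus (site_of_etaRateIneq342_torus)
open Literature.MathematicalPhysics.QuantumFieldTheory.Balaban1983to89.NE2NodeTorus (KnitIndex knitInstance knitOp knitOp166 knitSite163
  covOpKernels inAll rhoDist n15_knit_LG_dim4 n15zero_knit_LG ne2ZeroSite_knit_LG ne2ZeroUnit_cov_knit)
open Literature.MathematicalPhysics.QuantumFieldTheory.Balaban1983to89.B5Prop11Plancherel (Tor)
open Literature.MathematicalPhysics.QuantumFieldTheory.Balaban1983to89.B6LowerBound2153Torus (toT)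
open Literature.MathematicalPhysics.QuantumFieldTheory.Balaban1983to89.B4TorusKernel.MultiPeriod (torusSupNorm torusSupNorm_nonneg)
open Summit.QuantumFields.BalabanUV.T4Continuum.NE2KingTransplant (IsPseudoMetric UniformCoercive UniformCTBound UniformKernelDecay
  EffectiveOperatorSupRate VolumeSum CovarianceTowerRate covarianceTowerRate_of_leaves)

variable {d : ℕ}

/-! ## §1 Content, a located negative, and the node with its trivial-background layers at the knit carriers -/

section Content

variable (L : ℕ) [NeZero L]

/-- **CONTENT OF THE FIRST CONJUNCT AT THE KNIT CARRIERS (kernel answer to the vacuity audit).**  If `NE2PlusOperator c35` holds on PART 1's family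
`knitInstance d L` for the operator family of a torus family `X`, then there ARE `B₀, δ, γ > 0` with the `(k, N)`-UNIFORM King-shape step bound
`|X_N (k+1)(x̄) − X_N k(x̄)| ≤ B₀·e^{−δ|x|_{T,∞}}·(L^{−γ})^k` on EVERY unit torus whose periods are multiples of `L` — every guard of the packaged
type (`M₅ ≤ M`: take the index with `M = max M₅ 1`; `0 < α₀`, `Mα₀ ≤ a₀`: `α₀ = a₀∕M`; (3.35): trivial at `U ≡ 1`) is discharged, and the operator
inequality at entry `0` against the point mass returns the site bound (`T4EtaRateOperatorTorus.site_of_etaRateIneq342_torus`).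
[cite: Balaban1985BackgroundPropagators, Thm 3.1 p.397 (quantifier template); King1986, Lemma 4.5 (4.38) p.674 (the recovered shape)] [folklore] -/
theorem stepBound_of_N15op {X : TorusFamily d} {c35 : ℝ}
    (h : NE2PlusOperator c35 (knitInstance d L) (knitOp L X)) :
    ∃ B₀ δ γ : ℝ, 0 < B₀ ∧ 0 < δ ∧ 0 < γ ∧
      ∀ (N : Fin (d + 1) → ℕ) [∀ μ, NeZero (N μ)], (∀ μ, L ∣ N μ) → ∀ (k : ℕ) (x : Fin (d + 1) → ℤ),
        |X N (k + 1) (toT N x) - X N k (toT N x)| ≤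
          B₀ * Real.exp (-(δ * torusSupNorm N x)) * ((L : ℝ) ^ (-γ)) ^ k := by
  obtain ⟨M₅, δ, a₀, B₀, γ, hM, hδ, ha, hB, hγ, H⟩ := h
  refine ⟨B₀, δ, γ, hB, hδ, hγ, fun N _ hLN k x => ?_⟩
  have hL : (0 : ℝ) < L := by exact_mod_cast Nat.pos_of_ne_zero (NeZero.ne L)
  let i : KnitIndex d L := ⟨{ k := k, N := N, M := max M₅ 1, one_le := le_max_right _ _ }, hLN⟩
  have hMpos : (0 : ℝ) < max M₅ 1 := lt_of_lt_of_le one_pos (le_max_right _ _)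
  have hα : 0 < a₀ / max M₅ 1 := div_pos ha hMpos
  have hMa : max M₅ 1 * (a₀ / max M₅ 1) ≤ a₀ := by rw [mul_div_cancel₀ _ hMpos.ne']
  have h342 := H i (le_max_left _ _) (a₀ / max M₅ 1) hα hMa () trivial
  have hsite := site_of_etaRateIneq342_torus (N := N) hL (max M₅ 1) k (X N (k + 1)) (X N k) hB.le h342 0 0
  exact ((etaRateIneqSite_torus_iff_lattice hL (max M₅ 1) k (X N (k + 1)) (X N k) 0 0 B₀ δ γ ()).mp hsite) x

end Content

/-- **A LOCATED NEGATIVE: the first conjunct of N15 is FALSE for the rate-less family `X_N k ≡ 2^k` on the knit carriers** (`L = 2`, every `d`,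
every `c35`): by `stepBound_of_N15op` at the torus `N ≡ 2`, `x = 0`, the conjunct would force `2^k ≤ B₀` for all `k`.  So the node's type at
these carriers is not a consequence of the carrier bookkeeping: the rate content is genuine (PART 1's separating-family remark, now on the knit
family). [cite: King1986, Lemma 4.5 (4.38) p.674 (shape)] [folklore] -/
theorem not_N15op_rateless (d : ℕ) (c35 : ℝ) :
    ¬ NE2PlusOperator c35 (knitInstance d 2) (knitOp 2 (fun _ _ k _ => (2 : ℝ) ^ k)) := by
  intro h
  obtain ⟨B₀, δ, γ, hB, hδ, hγ, H⟩ := stepBound_of_N15op (d := d) 2 h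
  obtain ⟨k, hk⟩ := pow_unbounded_of_one_lt B₀ (by norm_num : (1 : ℝ) < 2)
  have h1 := H (fun _ => 2) (fun _ => dvd_rfl) k 0
  have htsn : (0 : ℝ) ≤ torusSupNorm (fun _ : Fin (d + 1) => 2) 0 := torusSupNorm_nonneg (fun _ => by norm_num) 0
  have hexp : Real.exp (-(δ * torusSupNorm (fun _ : Fin (d + 1) => 2) 0)) ≤ 1 :=
    Real.exp_le_one_iff.mpr (by nlinarith)
  have hθ1 : ((2 : ℝ) ^ (-γ)) ^ k ≤ 1 :=
    pow_le_one₀ (Real.rpow_nonneg (by norm_num) _) (Real.rpow_le_one_of_one_le_of_nonpos (by norm_num) (by linarith))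
  have hdiff : |(2 : ℝ) ^ (k + 1) - 2 ^ k| = 2 ^ k := by
    rw [pow_succ, show (2 : ℝ) ^ k * 2 - 2 ^ k = 2 ^ k by ring, abs_of_pos (pow_pos two_pos k)]
  have h2 : (2 : ℝ) ^ k ≤ B₀ := by
    calc (2 : ℝ) ^ k = |(2 : ℝ) ^ (k + 1) - 2 ^ k| := hdiff.symm
      _ ≤ B₀ * Real.exp (-(δ * torusSupNorm (fun _ : Fin (d + 1) => 2) 0)) * ((2 : ℝ) ^ (-γ)) ^ k := h1
      _ ≤ B₀ * 1 * 1 := by gcongr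
      _ = B₀ := by ring
  linarith

section Node

variable (L : ℕ) [NeZero L]

/-- **N15 FOR THE LANDAU-GAUGE VECTOR LINEAR THEORY AT `U ≡ 1` ON THE FOUR-DIMENSIONAL UNIT TORI, TOGETHER WITH ITS THREE TRIVIAL-BACKGROUND
LAYERS** (`L ≥ 2`, `μ ≠ ν`, all labels, every `c35`, `p`; hypothesis-free, uniform in `(k, N, M)`): PART 1's `n15_knit_LG_dim4` (the node:
Δ_k (1.66) operator layer at King's `γ = 2` ∧ H_k (1.63) site layer ∧ C^{(k)} (2.156) unit layer) ∧ (`NE2ZeroOperator` = venue `N15zero`,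
`NE2ZeroSite`, `NE2ZeroUnit`) by name.  HONEST SCOPE: NE2⁰ content inside the NE2⁺ type; not the background layer; not a discharge.
[cite: Balaban1984PropagatorsI, (1.63) p.28 and (1.66) p.29 (objects); Balaban1984PropagatorsII, (2.156) p.250 (object); Balaban1985BackgroundPropagators, Thm 3.1 p.397 + Thm 3.2 (3.48) p.398 + Thm 3.15 (3.187) p.432 (quantifier templates); King1986, Props. 3.8–3.9 pp.664–665 and Lemma 4.5 (4.38) p.674 (A = 0 templates)] [folklore] -/
theorem N15_with_zero_layers_dim4 (hL : 2 ≤ L) {μ ν : Fin 4} (hμν : μ ≠ ν) (a b μ' lam α β : Fin 4) (c35 p : ℝ) :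
    (NE2PlusOperator c35 (knitInstance 3 L) (knitOp166 L μ ν a b) ∧
      NE2PlusSite 4 p c35 (knitInstance 3 L) (knitSite163 L μ' lam) ∧
      NE2PlusUnit c35 (knitInstance 3 L) (covOpKernels L α β) (inAll L) (rhoDist L)) ∧
    (NE2ZeroOperator (knitInstance 3 L) (knitOp166 L μ ν a b) ∧
      NE2ZeroSite 4 p (knitInstance 3 L) (knitSite163 L μ' lam) ∧
      NE2ZeroUnit (knitInstance 3 L) (covOpKernels L α β) (inAll L) (rhoDist L)) :=
  ⟨n15_knit_LG_dim4 L hL hμν a b μ' lam α β c35 p,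
    n15zero_knit_LG (d := 3) L hμν a b, ne2ZeroSite_knit_LG (d := 3) L μ' lam 4 p,
    ne2ZeroUnit_cov_knit (d := 3) L (by norm_num) hL α β⟩

end Node

/-! ## §2 The socket of the background unit layer: King's scalar template transplanted to the node's typed unit conjunct -/

/-- **N15's UNIT CONJUNCT AT ANY BACKGROUND CARRIER FAMILY ⇐ KING'S COVARIANCE TOWER RATE, uniformly over the regular backgrounds.**
For a family of paired instances `pi` whose unit-layer kernel at instance `i`, configuration `U` and sites `y, y′` is the one-step
η-difference `(D_U (k+1) + B_U)⁻¹(e y, e y′) − (D_U k + B_U)⁻¹(e y, e y′)` (`k` = the coarse run's number of scales) of a tower of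
unit-lattice effective operators on a finite index set, King's (4.38)-shape tower rate `CovarianceTowerRate (D_U) (B_U) d C κ′ s` at every
`(3.35)∧(3.36)`-regular `U` (index-uniform constants, `0 < s < 1`) and `unitDist ≤ d ∘ e` give `NE2PlusUnit c35 pi Kd inΛ unitDist` with
`(δ₀, a₀, B₀, θ) = (κ′, a₀, C, s)`. [cite: King1986, Lemma 4.5 (4.38) p.674 (shape); Balaban1985BackgroundPropagators, Thm 3.15 (3.187) p.432 (quantifier template)] [folklore] -/
theorem N15unit_of_covarianceTowerRate {I : Type} {c35 a₀ : ℝ} (ha : 0 < a₀) {pi : I → PairedInstance}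
    {Kd : ∀ i, B9.SiteKernel (pi i).gc (pi i).Bf} {inΛ : ∀ i, (pi i).gc.Site → Prop}
    {unitDist : ∀ i, (pi i).gc.Site → (pi i).gc.Site → ℝ}
    {n : I → Type} [∀ i, Fintype (n i)] [∀ i, DecidableEq (n i)]
    (e : ∀ i, (pi i).gc.Site → n i) (dm : ∀ i, n i → n i → ℝ)
    (D : ∀ i, (pi i).Bf.Cfg → ℕ → Matrix (n i) (n i) ℝ) (B : ∀ i, (pi i).Bf.Cfg → Matrix (n i) (n i) ℝ)
    {C κ' s : ℝ} (hC : 0 < C) (hκ' : 0 < κ') (hs0 : 0 < s) (hs1 : s < 1)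
    (hdist : ∀ i y y', unitDist i y y' ≤ dm i (e i y) (e i y'))
    (hK : ∀ (i : I) (α₀ : ℝ), 0 < α₀ → (pi i).gf.M * α₀ ≤ a₀ → ∀ U : (pi i).Bf.Cfg,
      (pi i).Bf.Reg335 c35 α₀ U → (pi i).Bf.Reg336 c35 α₀ U →
        CovarianceTowerRate (D i U) (B i U) (dm i) C κ' s ∧
        ∀ y y', (Kd i).ker U y y' =
          (D i U ((pi i).gc.k + 1) + B i U)⁻¹ (e i y) (e i y') - (D i U (pi i).gc.k + B i U)⁻¹ (e i y) (e i y')) :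
    NE2PlusUnit c35 pi Kd inΛ unitDist := by
  refine ⟨κ', a₀, C, s, hκ', ha, hC, hs0, hs1, fun i α₀ hα hMa U h335 h336 y y' _ _ => ?_⟩
  obtain ⟨hT, hker⟩ := hK i α₀ hα hMa U h335 h336
  rw [hker y y', abs_sub_comm]
  refine (hT ((pi i).gc.k) (e i y) (e i y')).trans ?_
  have hexp : Real.exp (-(κ' * dm i (e i y) (e i y'))) ≤ Real.exp (-(κ' * unitDist i y y')) :=
    Real.exp_le_exp.mpr (by nlinarith [hdist i y y', hκ'.le])
  calc C * s ^ (pi i).gc.k * Real.exp (-(κ' * dm i (e i y) (e i y')))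
      ≤ C * s ^ (pi i).gc.k * Real.exp (-(κ' * unitDist i y y')) :=
        mul_le_mul_of_nonneg_left hexp (mul_nonneg hC.le (pow_nonneg hs0.le _))
    _ = C * Real.exp (-(κ' * unitDist i y y')) * s ^ (pi i).gc.k := by ring

/-- **N15's UNIT CONJUNCT AT ANY BACKGROUND CARRIER FAMILY ⇐ KING'S FOUR LEAVES (H1) coercivity ∧ (H2) Combes–Thomas bounds ∧ (H2′)
kernel decay ∧ (H3) one-step sup rate of the effective operators ∧ (H4) volume sum, UNIFORMLY OVER THE (3.35)∧(3.36)-REGULAR BACKGROUNDS** —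
the scalar template ([King1986] Lemma 4.5, kernel form `NE2KingTransplant.covarianceTowerRate_of_leaves`) transplanted to the node's typed unit
layer: constants `(δ₀, a₀, B₀, θ) = (κ/2, a₀, √(2C₁ε)·(γ − ρ − ρ_B)⁻²·V², √r)`.  (H1), (H2), (H2′), (H4) are ONE-RUN η-uniform bounds of
printed KIND; (H3) is the two-spacing leaf one layer below (effective operators) — at `U ≡ 1` a tree theorem ((1.66):
`T4Rate166StripDirect.W166_rate`), with background = the row's open estimate.  Nothing of Bałaban's is asserted: every leaf is a binder.
[cite: King1986, Lemma 4.5 (4.38) p.674 with (4.33)–(4.34), Lemma 4.3 (4.18) p.672 (the printed scalar template); Balaban1985BackgroundPropagators, Thm 3.15 (3.187) p.432 (quantifier template)] [folklore] -/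
theorem N15unit_of_kingLeaves {I : Type} {c35 a₀ : ℝ} (ha : 0 < a₀) {pi : I → PairedInstance}
    {Kd : ∀ i, B9.SiteKernel (pi i).gc (pi i).Bf} {inΛ : ∀ i, (pi i).gc.Site → Prop}
    {unitDist : ∀ i, (pi i).gc.Site → (pi i).gc.Site → ℝ}
    {n : I → Type} [∀ i, Fintype (n i)] [∀ i, DecidableEq (n i)]
    (e : ∀ i, (pi i).gc.Site → n i) (dm : ∀ i, n i → n i → ℝ)
    (D : ∀ i, (pi i).Bf.Cfg → ℕ → Matrix (n i) (n i) ℝ) (B : ∀ i, (pi i).Bf.Cfg → Matrix (n i) (n i) ℝ)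
    {γ κ ρ ρB ε C₁ V r : ℝ} (hγ : ρ + ρB < γ) (hκ : 0 < κ) (hε : 0 < ε) (hC₁ : 0 < C₁) (hV : 0 < V)
    (hr0 : 0 < r) (hr1 : r < 1) (hd : ∀ i, IsPseudoMetric (dm i))
    (hdist : ∀ i y y', unitDist i y y' ≤ dm i (e i y) (e i y'))
    (hK : ∀ (i : I) (α₀ : ℝ), 0 < α₀ → (pi i).gf.M * α₀ ≤ a₀ → ∀ U : (pi i).Bf.Cfg,
      (pi i).Bf.Reg335 c35 α₀ U → (pi i).Bf.Reg336 c35 α₀ U →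
        UniformCoercive (D i U) (B i U) γ ∧ UniformCTBound (D i U) (B i U) (dm i) κ ρ ρB ∧
        UniformKernelDecay (D i U) (dm i) C₁ κ ∧ EffectiveOperatorSupRate (D i U) ε r ∧ VolumeSum (dm i) κ V ∧
        ∀ y y', (Kd i).ker U y y' =
          (D i U ((pi i).gc.k + 1) + B i U)⁻¹ (e i y) (e i y') - (D i U (pi i).gc.k + B i U)⁻¹ (e i y) (e i y')) :
    NE2PlusUnit c35 pi Kd inΛ unitDist := by
  have hB₀ : 0 < Real.sqrt (ε * (2 * C₁)) * ((γ - (ρ + ρB))⁻¹) ^ 2 * V ^ 2 := by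
    have h1 : 0 < Real.sqrt (ε * (2 * C₁)) := Real.sqrt_pos.mpr (by positivity)
    have h2 : 0 < (γ - (ρ + ρB))⁻¹ := inv_pos.mpr (by linarith)
    positivity
  refine N15unit_of_covarianceTowerRate ha e dm D B hB₀ (half_pos hκ) (Real.sqrt_pos.mpr hr0)
    ((Real.sqrt_lt' one_pos).mpr (by simpa using hr1)) hdist fun i α₀ hα hMa U h335 h336 => ?_
  obtain ⟨h1, h2, h2', h3, h4, hker⟩ := hK i α₀ hα hMa U h335 h336
  exact ⟨covarianceTowerRate_of_leaves (D i U) (B i U) (dm i) (hd i) hγ hκ.le hε.le hr0.le h1 h2 h2' h3 h4, hker⟩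

end Summit.QuantumFields.YangMills.Theorems.BalabanUVNodesN15Knit

end
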